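import Summits.CriticalPhenomena.SAWScalingLimit.Theses.SAWCompassLattice
import Summits.CriticalPhenomena.SAWScalingLimit.Theses.SAWTrackTransport
import Literature.Probability.RandomPlanarGeometry.PortGadgetLattice
import Literature.Probability.RandomPlanarGeometry.SAWScalingLimitFamily

/-!
# Objects of the line `registered` (`Lines/birth.lean`, reshaped by the lead) for the crux
# `SAWCompassLattice.SurfaceUniversality` (stmt-CriticalPhenomena-6964)

Route `SAWCompassLattice` (sub-problem `SAWScalingLimit`). The crux: for every compass solution,
Dobrushin domain `D`, `ℤ²` endpoint approximation `(a, b)` and port endpoint approximation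
`(a', b')` at `Θ ≡ π/2`, the critical `ℤ²` SAW law `SAW.law` and the compass chordal law
`SAW.compassLaw` merge on all bounded continuous test functions of `CurveClass ℂ` as `δ → 0⁺`.

The line cuts the crux AT THE PLUS POINT of the port scaffold and AT BOUNDED-LIPSCHITZ LEVEL (the
`C_b` upgrade being one-sided tightness of the `ℤ²` walk, item stmt-CriticalPhenomena-1881, through
the one-sided Prokhorov upgrade of `…SurfaceUniversalityTightToll.lean`), and it identifies the plus
point with THE UNIFORM POINT `(u₁, u₂, v, w₁, w₂) = (x_c, x_c, x_c, 0, 0)` of Glazman–Manolescu's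
face-weight family on the square tiling (the `n = 0` square-lattice `O(n)` model of Blöte–Nienhuis:
a visited face costs `x_c` whatever the arc, a face visited twice costs `0`), so that the universality
kernel compares two points of ONE face-weight family on ONE walk space with ONE drawing. This file
only DEFINES the objects the registered stubs speak about and records the trivial implications
between them; no statement of the line is asserted:

* `fwLocalWeight u₁ u₂ v w₁ w₂`, `fwWeight`, `fwMeasure`, `fwLaw` — GM's face-weight walk on
  the square tiling with FREE local weights (empty face `1`; one `θ`-corner arc `u₁`, one
  `(π−θ)`-corner arc `u₂`, one straight arc `v`; two corner arcs `w₁`, two co-corner arcs `w₂`;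
  anything else `0`), its finite-domain measure and law on `YangBaxterSAW (π/2) Ω δ a b`;
  `localWeight_eq_fwLocalWeight` / `ybWeight_one_eq_fwMeasure` / `ybLaw_one_eq_fwLaw`: GM's critical
  law `ybLaw (π/2) Ω δ 1 a b` is the point `(u₁, u₂, v, w₁, w₂)(π/2)`;
* `unifLaw Ω δ a b := fwLaw x_c x_c x_c 0 0 Ω δ a b` — **the uniform point**: the critical `ℤ²`
  self-avoiding walk on the face centres, as a face-weight walk (faces visited twice killed);
* `plusLaw Ω δ a b` — **the critical plus-lattice chordal law** from port `a` to port `b`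
  (self-avoiding port–centre–…–port paths of `plusLattice` whose centres are faces of
  `meshFaces (π/2) Ω δ`, half-edge fugacity `√x_c`, drawn through ports AND centres) — birth's
  inline term, named;
* the stub statements as predicates: `LipPlusPointIsZ2` (`SAW.law` vs `plusLaw`; one model, two
  discretisations), `LipPlusIsUnif` (`plusLaw` vs `unifLaw` drawn by `YBWalk.curve`: an exact
  dictionary plus an `O(δ)` redraw — provable), `LipUnifToYB` (THE KERNEL: `unifLaw` vs
  `ybLaw (π/2)`, same walks, same drawing), and the derived `LipPlusToYB`, `LipYBtoUniform`;
* trivial implications: `lipPlusToYB_of_unif`, `lipYBtoUniform_of_lipPlus`,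
  `lipYBtoUniform_of_ybToUniform`, `lipPlusPointIsZ2_of_cb`, and conversely
  `lipUnifToYB_of_lipYBtoUniform` (the kernel is `YBtoUniform` at Lipschitz level modulo the two
  plus-side stubs, so it is staffed once with item stmt-CriticalPhenomena-16966).

Shared vocabulary: the birth skeleton of the sibling crux `SAWTrackTransport.YBtoUniform`
(stmt-CriticalPhenomena-16966, `Cruxes/YBtoUniform/Lines/birth.lean`) spells `plusLaw`,
`LipPlusPointIsZ2`, `LipPlusToYB`, `LipYBtoUniform` verbatim as here, so a theorem proving one of
these predicates by name closes the corresponding stub on both cruxes.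

Sources: A. Glazman, I. Manolescu, arXiv:1708.00395 §1 and Fig. 1 (the square-tiling walk, the six
local weights); H. W. J. Blöte, B. Nienhuis, J. Phys. A 22 (1989) 1415 (the square-lattice `O(n)`
model with general vertex weights, of which `n = 0` is this family); the line card
`Cruxes/SurfaceUniversality/Lines/birth.md` and `STRATEGY-CENSUS.md`. Deliberately NOT here: the stubs
as theorems, the composition (`…SurfaceUniversalityTightToll.lean`), the plus dictionary.
-/

noncomputable section

namespace Summit.CriticalPhenomena.SAWScalingLimit.Theorems.SurfaceUniversality

open MeasureTheory Filter Topology Set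
open scoped NNReal ENNReal BoundedContinuousFunction
open Literature.Probability.RandomPlanarGeometry
open Literature.Probability.RandomPlanarGeometry.SAW
open Literature.Probability.RandomPlanarGeometry.SAW.YangBaxter
open Literature.Probability.LatticeModels (Site)
open Summit.CriticalPhenomena.SAWScalingLimit.Theses

/-! ### GM's face-weight walk with free local weights (square tiling) -/

/-- **The local weight of a face with FREE parameters** `(u₁, u₂, v, w₁, w₂)`, as a function of
the arcs it contains (Glazman–Manolescu Fig. 1 / Blöte–Nienhuis): no arc `1`; one arc at a
`θ`-corner `u₁`, at a `(π−θ)`-corner `u₂`, straight `v`; two `θ`-corner arcs `w₁`, two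
`(π−θ)`-corner arcs `w₂`; every other configuration `0`. `localWeight θ` is the point
`(u₁, u₂, v, w₁, w₂)(θ)` (`localWeight_eq_fwLocalWeight`). [folklore] -/
def fwLocalWeight (u₁ u₂ v w₁ w₂ : ℝ) : List ArcKind → ℝ
  | [] => 1
  | [.corner] => u₁
  | [.coCorner] => u₂
  | [.straight] => v
  | [.corner, .corner] => w₁
  | [.coCorner, .coCorner] => w₂
  | _ => 0

/-- GM's weights (1) are the free local weight at `(u₁, u₂, v, w₁, w₂)(θ)`. [folklore] -/
theorem localWeight_eq_fwLocalWeight (θ : ℝ) (l : List ArcKind) :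
    localWeight θ l = fwLocalWeight (weightU1 θ) (weightU2 θ) (weightV θ) (weightW1 θ) (weightW2 θ) l := by
  unfold localWeight fwLocalWeight
  rcases l with _ | ⟨a, _ | ⟨b, _ | ⟨c, l⟩⟩⟩
  · rfl
  · cases a <;> rfl
  · cases a <;> cases b <;> rfl
  · cases a <;> cases b <;> rfl

/-- An empty face weighs `1`. [folklore] -/
@[simp] theorem fwLocalWeight_nil (u₁ u₂ v w₁ w₂ : ℝ) : fwLocalWeight u₁ u₂ v w₁ w₂ [] = 1 := rfl

/-- A face with three or more arcs weighs `0`. [folklore] -/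
theorem fwLocalWeight_three (u₁ u₂ v w₁ w₂ : ℝ) (a b c : ArcKind) (l : List ArcKind) :
    fwLocalWeight u₁ u₂ v w₁ w₂ (a :: b :: c :: l) = 0 := by
  unfold fwLocalWeight
  cases a <;> cases b <;> rfl

/-- With `w₁ = w₂ = 0` a face with two or more arcs weighs `0`. [folklore] -/
theorem fwLocalWeight_two_of_zero (u₁ u₂ v : ℝ) (a b : ArcKind) (l : List ArcKind) :
    fwLocalWeight u₁ u₂ v 0 0 (a :: b :: l) = 0 := by
  unfold fwLocalWeight
  rcases l with _ | ⟨c, l⟩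
  · cases a <;> cases b <;> rfl
  · cases a <;> cases b <;> rfl

/-- With `u₁ = u₂ = v = u` a face with exactly one (non-degenerate) arc weighs `u`. [folklore] -/
theorem fwLocalWeight_singleton (u w₁ w₂ : ℝ) {κ : ArcKind} (hκ : κ ≠ .degen) :
    fwLocalWeight u u u w₁ w₂ [κ] = u := by
  cases κ
  · rfl
  · rfl
  · rfl
  · exact absurd rfl hκ

section Walk

variable {D : Set Face} {a z : MidEdge}

/-- **The face weight of a walk with free local weights**: the product over the visited faces.
[folklore] -/
def fwWeight (u₁ u₂ v w₁ w₂ : ℝ) (γ : YBWalk D a z) : ℝ :=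
  ∏ f ∈ γ.facesVisited, fwLocalWeight u₁ u₂ v w₁ w₂ (γ.kindsIn f)

/-- GM's weight `w_Θ(γ)` at `Θ ≡ θ` is the free face weight at `(u₁, u₂, v, w₁, w₂)(θ)`. [folklore] -/
theorem weight_const_eq_fwWeight (θ : ℝ) (γ : YBWalk D a z) :
    γ.weight (fun _ => θ) = fwWeight (weightU1 θ) (weightU2 θ) (weightV θ) (weightW1 θ) (weightW2 θ) γ := by
  unfold YBWalk.weight fwWeight
  exact Finset.prod_congr rfl fun f _ => localWeight_eq_fwLocalWeight θ _

end Walk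

/-- **The face-weight walk measure of `Ω_δ` (square tiling) from `a` to `b` with free local
weights**: the walk `γ` gets mass `fwWeight γ` (clamped to `ℝ≥0∞`). [folklore] -/
def fwMeasure (u₁ u₂ v w₁ w₂ : ℝ) (Ω : Set ℂ) (δ : ℝ) (a b : MidEdge) :
    Measure (YangBaxterSAW rightAngles Ω δ a b) :=
  Measure.sum fun γ => ENNReal.ofReal (fwWeight u₁ u₂ v w₁ w₂ γ) • Measure.dirac γ

/-- **The face-weight walk law** (normalisation of `fwMeasure`; junk `0` if the mass is `0` or `∞`).
[folklore] -/
def fwLaw (u₁ u₂ v w₁ w₂ : ℝ) (Ω : Set ℂ) (δ : ℝ) (a b : MidEdge) :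
    Measure (YangBaxterSAW rightAngles Ω δ a b) :=
  (fwMeasure u₁ u₂ v w₁ w₂ Ω δ a b Set.univ)⁻¹ • fwMeasure u₁ u₂ v w₁ w₂ Ω δ a b

/-- GM's critical measure on the square tiling (`x = 1`) is the face-weight measure at
`(u₁, u₂, v, w₁, w₂)(π/2)`. [folklore] -/
theorem ybWeight_one_eq_fwMeasure (Ω : Set ℂ) (δ : ℝ) (a b : MidEdge) :
    ybWeight rightAngles Ω δ 1 a b = fwMeasure (weightU1 (Real.pi / 2)) (weightU2 (Real.pi / 2))
      (weightV (Real.pi / 2)) (weightW1 (Real.pi / 2)) (weightW2 (Real.pi / 2)) Ω δ a b := by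
  unfold ybWeight fwMeasure
  congr 1
  funext γ
  rw [Real.one_rpow, mul_one, weight_const_eq_fwWeight]

/-- **GM's critical law `ybLaw (π/2) Ω δ 1 a b` is the face-weight law at the integrable point
`(u₁, u₂, v, w₁, w₂)(π/2) ≈ (0.4084, 0.4084, 0.3209, 0.1127, 0.1127)`.** [folklore] -/
theorem ybLaw_one_eq_fwLaw (Ω : Set ℂ) (δ : ℝ) (a b : MidEdge) :
    ybLaw rightAngles Ω δ 1 a b = fwLaw (weightU1 (Real.pi / 2)) (weightU2 (Real.pi / 2))
      (weightV (Real.pi / 2)) (weightW1 (Real.pi / 2)) (weightW2 (Real.pi / 2)) Ω δ a b := by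
  rw [ybLaw, fwLaw, ybWeight_one_eq_fwMeasure]

/-! ### The uniform point and the plus law -/

/-- **The uniform point** of the face-weight family: the law `fwLaw x_c x_c x_c 0 0` on the
Yang–Baxter walks of `Ω_δ` (square tiling) from `a` to `b` — a visited face costs the critical
`ℤ²` fugacity `x_c = SAW.criticalFugacity` whatever its arc, a face visited twice is killed. Its
walks of positive weight are exactly the port sequences of the self-avoiding plus paths, i.e. the
critical `ℤ²` self-avoiding walks on the face centres between the faces of the end ports
(`LipPlusIsUnif`). [folklore] -/
def unifLaw (Ω : Set ℂ) (δ : ℝ) (a b : MidEdge) : Measure (YangBaxterSAW rightAngles Ω δ a b) :=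
  fwLaw SAW.criticalFugacity SAW.criticalFugacity SAW.criticalFugacity 0 0 Ω δ a b

/-- **The critical plus-lattice chordal law** of `Ω_δ` from port `a` to port `b`: self-avoiding
port–centre–port–…–port paths of the plus lattice whose centres are faces of `meshFaces (π/2) Ω δ`,
weight `(√x_c)^{#darts} = x_c^{#centres}` (`walkWeight_plusFugacity`), normalised, pushed to
`CurveClass ℂ` by the rescaled polyline through ports (side midpoints) and centres — the `W = Unit`,
`p = √x_c` instance of the generic `PortGadget.pathLaw` whose compass instance is `SAW.compassLaw`.
Birth's skeleton writes this term inline; `plusLaw` is it by `rfl` (`plusLaw_eq_pathLaw`). [folklore] -/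
def plusLaw (Ω : Set ℂ) (δ : ℝ) (a b : MidEdge) : Measure (CurveClass ℂ) :=
  PortGadget.pathLaw plusLattice (plusFugacity (Real.sqrt SAW.criticalFugacity))
    (PortGadget.embed plusPos) (PortGadget.inFaces (meshFaces rightAngles Ω δ)) δ
    (Sum.inl a) (Sum.inl b)

/-- `plusLaw` unfolds to birth's inline `PortGadget.pathLaw …` term. [folklore] -/
theorem plusLaw_eq_pathLaw (Ω : Set ℂ) (δ : ℝ) (a b : MidEdge) :
    plusLaw Ω δ a b = PortGadget.pathLaw plusLattice (plusFugacity (Real.sqrt SAW.criticalFugacity))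
      (PortGadget.embed plusPos) (PortGadget.inFaces (meshFaces rightAngles Ω δ)) δ
      (Sum.inl a) (Sum.inl b) := rfl

/-! ### The statements of the line as predicates -/

/-- STUB STATEMENT `LipPlusPointIsZ2` (**the plus point is `ℤ²`, at bounded-Lipschitz level**; one
model): for every Dobrushin domain, every `ℤ²` endpoint approximation `(a, b)` and every port
endpoint approximation `(a', b')` at `Θ ≡ π/2`, the critical `δℤ²` SAW law of the summit and the
critical plus-lattice law between the ports merge on bounded LIPSCHITZ test functions. The
deterministic parts (half-mesh translation, polyline through ports-and-centres vs through centres)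
cost `≤ δ` in `CurveClass ℂ` and are free at Lipschitz level; what remains is insensitivity, in
bounded-Lipschitz distance, of the critical chordal `ℤ²` law to the `O(δ)` boundary layer of the
discretisation (`discreteDomainGraph` vs the faces of `meshFaces`) and to an `o(1)` displacement of
the boundary endpoints (Lawler–Schramm–Werner 2004 §3.4.2 phrase the scaling-limit conjecture for any
lattice approximation; unproved). OPEN named conjecture of this line (obligation node, registered stub
`stub_lipPlusPointIsZ2` of crux stmt-CriticalPhenomena-6964; NOT a literature fact).
[cite: LawlerSchrammWerner2004SAW, §3.4.2 (independence of the lattice approximation of domain and endpoints, conjectural)] -/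
@[conjecture] def LipPlusPointIsZ2 : Prop :=
  ∀ (D : DobrushinDomain) (a b : ℝ → Site 2) (a' b' : ℝ → MidEdge),
    SAW.IsEndpointApprox D a b → IsYBEndpointApprox rightAngles D a' b' →
    ∀ (f : BoundedContinuousFunction (CurveClass ℂ) ℝ) (L : ℝ≥0), LipschitzWith L f →
      Tendsto (fun δ : ℝ => (∫ γ, f γ.curve ∂(SAW.law D.carrier δ (a δ) (b δ))) -
          ∫ x, f x ∂(plusLaw D.carrier δ (a' δ) (b' δ))) (𝓝[>] (0 : ℝ)) (𝓝 0)

/-- STUB STATEMENT `LipPlusIsUnif` (**the plus law IS the uniform point, up to an `O(δ)` redraw**;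
provable): for every domain and all families of ports, the plus law (drawn through ports and
centres) and the uniform face-weight law `unifLaw` drawn by `YBWalk.curve` (through ports only)
merge on bounded Lipschitz test functions — in fact `‖…‖ ≤ L·|δ|`: the port sequence of a plus
path is a Yang–Baxter walk visiting no face twice, this is a weight-preserving bijection onto the
walks of positive uniform weight (`x_c^{#faces}` on both sides), and the two drawings of one path
are at uniform distance `≤ δ/2`. No hypothesis: both laws are junk (`0`) simultaneously. Named obligation of
this line (registered stub `stub_lipPlusIsUnif` of crux stmt-CriticalPhenomena-6964; bookkeeping, being proved in
`…SurfaceUniversalityLipPlusIsUnif.lean`; NOT a literature fact — the face-weight language is Glazman–Manolescu's).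
[cite: GlazmanManolescu2019, §1 and Fig. 1 (the face-weight walk on the square tiling; the identification with the plus lattice is this line's)] -/
@[conjecture] def LipPlusIsUnif : Prop :=
  ∀ (Ω : Set ℂ) (a b : ℝ → MidEdge) (f : BoundedContinuousFunction (CurveClass ℂ) ℝ) (L : ℝ≥0),
    LipschitzWith L f →
      Tendsto (fun δ : ℝ => (∫ x, f x ∂(plusLaw Ω δ (a δ) (b δ))) -
          ∫ γ, f (γ.curve rightAngles δ) ∂(unifLaw Ω δ (a δ) (b δ))) (𝓝[>] (0 : ℝ)) (𝓝 0)

/-- STUB STATEMENT `LipUnifToYB` (**THE KERNEL: the uniform point vs the integrable point of the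
face-weight family, at bounded-Lipschitz level**): for every Dobrushin domain and every port
endpoint approximation at `Θ ≡ π/2`, the uniform face-weight law `unifLaw = fwLaw x_c x_c x_c 0 0`
(the critical `ℤ²` SAW on the face centres) and Glazman–Manolescu's critical Yang–Baxter law
`ybLaw (π/2) Ω δ 1 a b = fwLaw (u₁, u₂, v, w₁, w₂)(π/2)` (`ybLaw_one_eq_fwLaw`;
`≈ (0.4084, 0.4084, 0.3209, 0.1127, 0.1127)`) — two points of ONE family on ONE walk space
`YangBaxterSAW (π/2) Ω δ a b`, drawn by ONE map `YBWalk.curve` — merge on bounded Lipschitz test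
functions; equivalently their bounded-Lipschitz (Dudley) distance tends to `0`. This is planar SAW
universality between the uniform and the integrable `n = 0` point of the square lattice, with
tightness and every convention factored out. OPEN named conjecture of this line (obligation node, registered
stub `stub_lipUnifToYB` of crux stmt-CriticalPhenomena-6964; NOT a literature fact).
[cite: GlazmanManolescu2019, §1 (the weights (1) "may be considered critical"; universality of the 2-point function and of the connective constant across the Yang–Baxter family, Thms 1–3 — the law-level comparison with the uniform walk is NOT claimed there)]
[cite: LawlerSchrammWerner2004SAW, §3.4.2 and §4.1 Prediction 1 (one scaling limit for planar SAW, conjectural)] -/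
@[conjecture] def LipUnifToYB : Prop :=
  ∀ (D : DobrushinDomain) (a' b' : ℝ → MidEdge), IsYBEndpointApprox rightAngles D a' b' →
    ∀ (f : BoundedContinuousFunction (CurveClass ℂ) ℝ) (L : ℝ≥0), LipschitzWith L f →
      Tendsto (fun δ : ℝ => (∫ γ, f (γ.curve rightAngles δ) ∂(unifLaw D.carrier δ (a' δ) (b' δ))) -
          ∫ γ, f (γ.curve rightAngles δ) ∂(ybLaw rightAngles D.carrier δ 1 (a' δ) (b' δ)))
        (𝓝[>] (0 : ℝ)) (𝓝 0)

/-- DERIVED STATEMENT `LipPlusToYB` (plus law vs `ybLaw (π/2)` at bounded-Lipschitz level; the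
kernel of skeleton v2, `= LipPlusIsUnif + LipUnifToYB`, `lipPlusToYB_of_unif`); also the registered stub
`stub_lipPlusToYB` of the sibling crux stmt-CriticalPhenomena-16966. OPEN named conjecture (obligation node;
NOT a literature fact). [cite: LawlerSchrammWerner2004SAW, §3.4.2 and §4.1 Prediction 1 (one scaling limit for planar SAW, conjectural)] -/
@[conjecture] def LipPlusToYB : Prop :=
  ∀ (D : DobrushinDomain) (a' b' : ℝ → MidEdge), IsYBEndpointApprox rightAngles D a' b' →
    ∀ (f : BoundedContinuousFunction (CurveClass ℂ) ℝ) (L : ℝ≥0), LipschitzWith L f →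
      Tendsto (fun δ : ℝ => (∫ x, f x ∂(plusLaw D.carrier δ (a' δ) (b' δ))) -
          ∫ γ, f (γ.curve rightAngles δ) ∂(ybLaw rightAngles D.carrier δ 1 (a' δ) (b' δ)))
        (𝓝[>] (0 : ℝ)) (𝓝 0)

/-- `SAWTrackTransport.YBtoUniform` (stmt-CriticalPhenomena-16966) restricted to bounded Lipschitz
test functions: the critical `ℤ²` law vs GM's square-tiling law (the hypothesis `hU` of
`Theorems.SurfaceUniversality.surfaceUniversality_of_tight_of_lipMerge`). OPEN named conjecture
(obligation node: item stmt-16966 restricted to Lipschitz test functions; NOT a literature fact).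
[cite: LawlerSchrammWerner2004SAW, §3.4.2 and §4.1 Prediction 1 (one scaling limit for planar SAW, conjectural)] -/
@[conjecture] def LipYBtoUniform : Prop :=
  ∀ (D : DobrushinDomain) (a b : ℝ → Site 2) (a' b' : ℝ → MidEdge),
    SAW.IsEndpointApprox D a b → IsYBEndpointApprox rightAngles D a' b' →
    ∀ (f : BoundedContinuousFunction (CurveClass ℂ) ℝ) (L : ℝ≥0), LipschitzWith L f →
      Tendsto (fun δ : ℝ => (∫ γ, f γ.curve ∂(SAW.law D.carrier δ (a δ) (b δ))) -
          ∫ γ, f (γ.curve rightAngles δ) ∂(ybLaw rightAngles D.carrier δ 1 (a' δ) (b' δ)))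
        (𝓝[>] (0 : ℝ)) (𝓝 0)

/-! ### Trivial implications -/

/-- The plus dictionary and the kernel add up to skeleton v2's kernel:
`(∫dPlus − ∫dUnif) + (∫dUnif − ∫dYB) → 0`. [folklore] -/
theorem lipPlusToYB_of_unif : LipPlusIsUnif → LipUnifToYB → LipPlusToYB := by
  intro hP hK D a' b' hab' f L hf
  have h := (hP D.carrier a' b' f L hf).add (hK D a' b' hab' f L hf)
  rw [add_zero] at h
  exact h.congr fun δ => sub_add_sub_cancel _ _ _

/-- The two Lipschitz legs add up to `LipYBtoUniform`:
`(∫dP^{ℤ²} − ∫dPlus) + (∫dPlus − ∫dYB) → 0`. [folklore] -/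
theorem lipYBtoUniform_of_lipPlus (hZ : LipPlusPointIsZ2) (hK : LipPlusToYB) : LipYBtoUniform := by
  intro D a b a' b' hab hab' f L hf
  have h := (hZ D a b a' b' hab hab' f L hf).add (hK D a' b' hab' f L hf)
  rw [add_zero] at h
  exact h.congr fun δ => sub_add_sub_cancel _ _ _

/-- The `C_b` toll `SAWTrackTransport.YBtoUniform` (stmt-16966) gives its Lipschitz restriction.
[folklore] -/
theorem lipYBtoUniform_of_ybToUniform (h : SAWTrackTransport.YBtoUniform) : LipYBtoUniform :=
  fun D a b a' b' hab hab' f _ _ => h D a b a' b' hab hab' f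

/-- Birth's original `C_b`-level stub 1 (`PlusPointIsZ2`, restated verbatim as a hypothesis)
implies the Lipschitz-level stub `LipPlusPointIsZ2`: the reshaped stub is WEAKER. [folklore] -/
theorem lipPlusPointIsZ2_of_cb
    (h : ∀ (D : DobrushinDomain) (a b : ℝ → Site 2) (a' b' : ℝ → MidEdge),
      SAW.IsEndpointApprox D a b → IsYBEndpointApprox rightAngles D a' b' →
      ∀ f : BoundedContinuousFunction (CurveClass ℂ) ℝ,
        Tendsto (fun δ : ℝ => (∫ γ, f γ.curve ∂(SAW.law D.carrier δ (a δ) (b δ))) -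
            ∫ x, f x ∂(PortGadget.pathLaw plusLattice (plusFugacity (Real.sqrt SAW.criticalFugacity))
              (PortGadget.embed plusPos) (PortGadget.inFaces (meshFaces rightAngles D.carrier δ)) δ
              (Sum.inl (a' δ)) (Sum.inl (b' δ))))
          (𝓝[>] (0 : ℝ)) (𝓝 0)) :
    LipPlusPointIsZ2 :=
  fun D a b a' b' hab hab' f _ _ => h D a b a' b' hab hab' f

/-- **The kernel is `YBtoUniform` at Lipschitz level, modulo the line's other two Lipschitz
stubs**: `LipYBtoUniform → LipPlusPointIsZ2 → LipPlusIsUnif → LipUnifToYB`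
(`∫dUnif − ∫dYB = (∫dP^{ℤ²} − ∫dYB) − (∫dP^{ℤ²} − ∫dPlus) − (∫dPlus − ∫dUnif)`, using some `ℤ²`
endpoint approximation of `D`, which exists by `SAW.exists_isEndpointApprox`). With
`lipYBtoUniform_of_lipPlus`/`lipPlusToYB_of_unif` this shows the three Lipschitz stubs of the line
are jointly EQUIVALENT to `LipYBtoUniform` + the two plus-side stubs — the kernel is staffed once
(cf. item stmt-CriticalPhenomena-16966). [folklore] -/
theorem lipUnifToYB_of_lipYBtoUniform (hU : LipYBtoUniform) (hZ : LipPlusPointIsZ2)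
    (hP : LipPlusIsUnif) : LipUnifToYB := by
  intro D a' b' hab' f L hf
  obtain ⟨a, b, hab⟩ := SAW.exists_isEndpointApprox D
  have h := ((hU D a b a' b' hab hab' f L hf).sub (hZ D a b a' b' hab hab' f L hf)).sub
    (hP D.carrier a' b' f L hf)
  rw [sub_zero, sub_zero] at h
  exact h.congr fun δ => by ring

end Summit.CriticalPhenomena.SAWScalingLimit.Theorems.SurfaceUniversality

end
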